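import Summits.BirchSwinnertonDyer.BirchSwinnertonDyer.Theorems.ByReductionTypeAtTwoKatoFreeSandwich
import Summits.BirchSwinnertonDyer.BirchSwinnertonDyer.Theorems.ByReductionTypeAtTwoOrdMissingLowerBoundAtTwoStubMaxPeriodWitness
import Summits.BirchSwinnertonDyer.BirchSwinnertonDyer.Theorems.ByReductionTypeAtTwoKatoFreeSandwichMeasureDepth
import Summits.BirchSwinnertonDyer.BirchSwinnertonDyer.Theorems.ByReductionTypeAtTwoAnalyticMuEisensteinFlat
import Summits.BirchSwinnertonDyer.BirchSwinnertonDyer.Theorems.ByReductionTypeAtTwoFlatWitnessSquare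
import Summits.BirchSwinnertonDyer.BirchSwinnertonDyer.Theorems.ByReductionTypeAtTwoPeriodDescentGamma1
import Summits.BirchSwinnertonDyer.BirchSwinnertonDyer.Theses.ByReductionTypeAtTwo
import Summits.BirchSwinnertonDyer.BirchSwinnertonDyer.Theses.TwoAdicConverse
import HarnessLib

/-!
# Crux `OrdMissingLowerBoundAtTwo` (stmt-BirchSwinnertonDyer-19577, K4 route `ByReductionTypeAtTwo`, rank 203) —
# line `kato-free-lower-sandwich-two`, SKELETON v12 (lead `cruxlead-stmt-BirchSwinnertonDyer-19577` g0 → g2, 2026-08-28)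

v12 (lead g2) = **THE LINE IS COMPLETE MODULO CITE-LEVEL NAMED FACTS AND THE EXTERNAL CRUX 19556.**  The research stub (β)
`stub_periodDescentOfEisenstein` is now the THEOREM `AnalyticMuTwo.periodDescentOfEisenstein_of_gamma1Optimal`
(`Theorems/ByReductionTypeAtTwoPeriodDescentGamma1.lean`; lattice route of crux-triage r1-1 GEN 10, `TRIAGE_r1_1_BetaViaE1.lean`,
ported): if the integer period functional of `f` is Eisenstein mod `2^{s+1}` then `2^{s+1} ∣ m` on `Γ₁(N)`, so `re Λ₁(f) ⊆ 2ˢΩ⁺_f ℤ`,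
and the `X₁(N)`-OPTIMAL curve `W₁` of the class (`Λ_{W₁} = c₁Λ₁(f)`, `c₁ ∈ ℤ`; `Ω(W₁)/2 ∈ re Λ_{W₁}`) has
`Ω(W₁) = j·c₁·2^{s+1}·Ω⁺_f` while `Ω(E₀) = |c₀|·Ω⁺_f` with `c₀` odd (Abbes–Ullmo): `W₃ := W₁`, `v₂(r) ≥ s+1`.  Its only input
beyond the tree is the Literature named fact `exists_optimal_gamma1ParametrizationData` (the `X₁(N)`-optimal curve of an
`X₀(N)`-optimal class: Stevens 1989 §2, Conrad–Edixhoven–Stein 2003 §6.1 — already consumed by other K4 lines), carried BY NAME as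
the cite-level stub `stub_gamma1Optimal`.  **3 registered stubs, all by-name / external**: stub_pub [cite: 19149 ∧ 19567 ∧ AU] ·
stub_gamma1Optimal [cite: CES/Stevens] · stub_lambdaHalf [crux 19556].  Everything the line itself posited — the spine, the
max-period selector, μ-transport, S2 (both halves), S3 = (★) + THEOREM B at 2 + (W) at every odd level (Dirichlet), (β) — is
kernel-checked.  The crux 19577 is therefore EXACTLY as open as 19556 `OrdLambdaHalfAtTwo` plus the published inputs.

v11 (lead g2) = **the flat witness (W) is a KERNEL THEOREM at EVERY odd level** — the registered stub `stub_flatWitnessAtTwoComposite`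
LANDED verbatim (`Theorems/ByReductionTypeAtTwoFlatWitnessSquare.lean`, `FlatWitnessTwo.flatWitnessAtTwo` /
`FlatWitnessTwo.stub_flatWitnessAtTwoComposite`, on `…FlatWitnessPrime` (prime levels, `N = 1`), `…FlatWitnessNonsquare` (`−1` not a
square: `H₋ = {u : u^{3N} = ±1}`, parabolic witness) and `…SL2ZTorsion` (finite order in `SL(2, ℤ)` ⟹ `γ¹² = 1`)).  The last case —
`−1` a square mod `N`, the family of the 196 «product» levels — is settled UNIFORMLY: `S = ⟨√−1⟩`, `H = {u : u^{3N} ∈ S}` admissible,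
`w = 2^{3Nr}` (`r` = order of `2` mod `H`) has `w² = ±1`; `w² = −1` ⟹ single order-4 witness; `w² = 1` ⟹ DIRICHLET's theorem
(Mathlib `Nat.forall_exists_prime_gt_and_eq_mod`, modulus `8N`) supplies a prime `ℓ ≡ 7 (mod 8)`, `ℓ ≡ √−1 (mod N)`, for which `2`
is a square, so `2^{(ℓ−1)/2} ≡ 1 (mod ℓ)` with `(ℓ−1)/2` odd, and the product of the two order-4 elements `(−ℓ, −1; ℓ²+1, ℓ)`,
`(−d₂, −1; d₂²+1, d₂)` (`d₂ = ℓ − (2ᵏ−1)/ℓ`, `k = 3N·r·(ℓ−1)/2`) has lower-right entry `−2ᵏ`.  So S3 («flat ⟹ Eisenstein») is now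
a theorem outright: (★) + (W) + THEOREM B at `p = 2`.  **3 registered stubs remain**: stub_pub [cite] · stub_lambdaHalf [19556 external] ·
stub_periodDescentOfEisenstein [(β), the research heart — lead recommendation: PROMOTE with the (β0)–(β2) split].

v10 (lead g2) = v9 with (W) PROVED moreover at every odd level `N` where `−1` is NOT a square (every `N` with a prime factor
`≡ 3 (mod 4)`): `Theorems/ByReductionTypeAtTwoFlatWitnessNonsquare.lean`, `FlatWitnessTwo.flatWitnessAtTwo_of_not_isSquare_neg_one`
(`H₋ = {u : u^{3N} = ±1}` is admissible by the killed-entry classification `gamma0Map_cases_of_killed` — finite order or trace `±2` ⟹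
`(d ∓ 1)² ≡ 0 ∨ d² + 1 ≡ 0 ∨ d² ∓ d + 1 ≡ 0`, whence `d^N ≡ ±1` (binomial theorem, `(d ∓ 1)² = 0`) or `d³ ≡ ±1`, the case `d² ≡ −1`
being excluded; witness = the parabolic element with `d = 2ᵏ`, `k = ord(2 mod ±1)`; `2ᵉ ∈ H₋ ⟹ k ∣ 3Ne ⟹ gcd(k,4) ∣ e`).  The registered
stub shrinks VERBATIM to `stub_flatWitnessAtTwoResidual`: composite odd `N > 1` with `−1` a square mod `N` (all prime factors
`≡ 1 (mod 4)`) — exactly the family carrying the product-witness levels (196 of them `≤ 30000`); `flatWitnessAtTwo_all` reassembles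
through `FlatWitnessTwo.flatWitnessAtTwo_of_residual`.  4 registered stubs (`stubs_max`): stub_pub [cite] · stub_lambdaHalf
[19556 external] · stub_flatWitnessAtTwoResidual [(W) residual] · stub_periodDescentOfEisenstein [(β), research heart — PROMOTE].

v9 (lead g2) = v8 with the flat witness (W) PROVED AT EVERY PRIME LEVEL and at `N = 1`
(`Theorems/ByReductionTypeAtTwoFlatWitnessPrime.lean`, `FlatWitnessTwo.flatWitnessAtTwo_prime`: `H = {u : u¹² = 1}`, `r = ord(2¹²)`,
one parabolic / elliptic witness from the 12-th-root-of-unity case split of `2ʳ ∈ 𝔽_p`; on `Theorems/ByReductionTypeAtTwoSL2ZTorsion.lean`: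
finite order in `SL(2, ℤ)` ⟹ `γ¹² = 1`), so the registered stub shrinks VERBATIM to the composite odd levels `N > 1`:
`stub_flatWitnessAtTwoComposite`; `flatWitnessAtTwo_all` (a theorem) reassembles (W) at every odd level through
`FlatWitnessTwo.flatWitnessAtTwo_of_composite`.  Status of the residual: certified by kit at every odd `N ≤ 30000` (crux-triage
r1-2 §N2: single witnesses settle all but 196 levels, those are squarefree products of primes `≡ 1 (mod 4)` with
`v₂(r_G) ≤ 1 < v₂(ord(2 mod ±1))` and need a product of two order-4 elements `ε₁ε₂`, `d(ε₁ε₂) = d₁(d₂ − d₁) − 1 = ±2ᵏ`, i.e. a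
divisor `d₁ ∣ 2ᵏ ∓ 1` with `d₁² ≡ −1 (mod N)`); as a ∀-statement on that family it follows from «every coprime class mod `N` contains
a prime `ℓ` with `ord_ℓ(2)` odd» (Hasse-type density, Chebotarev) and has no elementary proof on file.  4 registered stubs
(`stubs_max`): stub_pub [cite] · stub_lambdaHalf [19556 external] · stub_flatWitnessAtTwoComposite [(W) residual] ·
stub_periodDescentOfEisenstein [(β), research heart — lead recommendation: PROMOTE with the (β0)–(β2) split].

v8 = v7 with the span residual (α) `stub_spanResidualAtTwo` («`ConjSpanGen N 4 ∧ ConjSpanGen N 16` for every odd `N`»,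
THEOREM B′/B″ — no proof idea, certified at odd `N ≤ 2001`) REPLACED by the strictly more plausible, purely arithmetic
`stub_flatWitnessAtTwo` = card #8's GEN-8 residual (W) `FlatWitnessAtTwo` (certified by kit at EVERY odd `N ≤ 30000`,
0 exceptions): S3 now runs on THEOREM B at `p = 2` ALONE (in the tree) through the kernel theorem (★)
`AnalyticMuTwo.factorsThroughD_of_flat` (`Theorems/ByReductionTypeAtTwoAnalyticMuEisensteinFlat.lean`): a flat functional of
slope `sl` is Eisenstein as soon as `ord sl ∣ ord(2 mod H)` for an admissible `H ≤ (ℤ/N)ˣ`, and (W) + S2's `ord sl ∣ 4` give that.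

v7 = v6 with the research stub SPLIT along card #8's last seam, now that S2 (both halves: `…AnalyticMuDepth` p656427,
`…AnalyticMuFlat` p658372, `…AnalyticMuFlatPackage` p658737) and S3 (`…AnalyticMuEisenstein`, flat ⟹ Eisenstein, ported
from the crux-dir sketch; THEOREM B theses-free) are kernel theorems: `stub_periodDescentOfMeasureDepth` is derived
(`AnalyticMuTwo.periodDescentOfMeasureDepth_of_eisensteinDescent`) from TWO registered stubs —
* `stub_spanResidualAtTwo` = (α) the GROUP-THEORETIC residual «`ConjSpanGen N 4 ∧ ConjSpanGen N 16` for every odd `N`»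
  (kit-certified by the triage/ideator seats at every odd `N ≤ 2001`, P ∈ {4,8,16}) — REPLACED in v8 by `stub_flatWitnessAtTwo`,
* `stub_periodDescentOfEisenstein` = (β) S4, THE RESEARCH HEART, stated purely arithmetically at the optimal curve: an
  integer period functional `m` of the optimal newform (`re{∞,γ∞} = m(γ)·Ω⁺/2`) that is EISENSTEIN mod `2^{s+1}`
  (`m ≡ χ∘(d mod N)`) forces a globally minimal class member `W₃` with `Ω(W₃) = r·Ω(E₀)`, `v₂(r) ≥ s+1`
  (Mazur 1977 II.11 / Stein–Watkins 2004 L3.1–P3.2 at prime `N`, `s = 0`; composite `N` / depth ≥ 2 is the open part).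
4 registered stubs (`stubs_max`): stub_pub [cite] · stub_lambdaHalf [19556 external] · stub_flatWitnessAtTwo [(W)] ·
stub_periodDescentOfEisenstein [(β)].

v6 = v5 with the research stub RESHAPED ONCE MORE, into its arithmetic heart at the `X₀(N)`-optimal curve:
`stub_analyticMuLEAtMaxPeriod` («`AnalyticMuLE W″ 2 0` at the max-period member») is replaced by the EQUIVALENT (kernel:
`KatoFreeSandwich.stubAtMaxPeriod_of_periodDescentOfMeasureDepth` / `periodDescentOfMeasureDepth_of_stubAtMaxPeriod`,
`Theorems/ByReductionTypeAtTwoKatoFreeSandwichMeasureDepth.lean`, mod PUB-modularity + Abbes–Ullmo)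
`stub_periodDescentOfMeasureDepth` («MEASURE DEPTH ⟹ PERIOD DESCENT»: if the Mazur–Swinnerton-Dyer measure of the optimal
curve's newform vanishes mod `2^{s+1}` on `ℤ₂^×`, some globally minimal member of the class has real period `r·Ω(E₀)` with
`v₂(r) ≥ s+1`).  What moved into PROVED land since v5: S2's analytic half at every depth (`…AnalyticMuDepth`, p656427:
`¬ AnalyticMuLE E₀ 2 s` ⟹ measure depth `s+1`, mod AU), the general `μ`-transport and the optimal-curve re-centring
(`…KatoFreeSandwichOptimalTower`, p655109), unconditional rationality of period ratios (Milne).  What the new stub still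
contains (card #8): S2's recursion half (measure depth ⟹ `2^{s+1}`-flat winding functional), S3 (flat ⟹ Eisenstein, proved in
the crux-dir sketch mod the span residual (α)), and (β) S4 `PeriodDescentOfEisensteinAtTwo` — the research heart.

v5 = v4 with `stub_maxPeriodWitness` LANDED (p653776, `Theorems/ByReductionTypeAtTwoOrdMissingLowerBoundAtTwoStubMaxPeriodWitness.lean`,
`KatoFreeSandwich.stub_maxPeriodWitness`) and therefore no longer a stub: 3 sorries remain (stub_pub [cite], stub_lambdaHalf
[external 19556], stub_analyticMuLEAtMaxPeriod [the line's research crux]).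

v4 = v3 (crux-plan g0 @646be4e56a48, registered by the lead 2026-08-28T17:2xZ) with
(a) the PROVED spine §0–§1b now IMPORTED from the tree (`Theorems/ByReductionTypeAtTwoKatoFreeSandwich.lean`, p652707,
    namespace `…Theorems.KatoFreeSandwich`), re-keyed to the tree's certificate currency `X1.MuPart.AnalyticMuLE W 2 0`
    (coefficient form) instead of the local def `AnalyticMuNonpos` (slack form; `mu_le_slack_of_analyticMuLE` is the passage,
    and on the good-ordinary locus nothing is lost) — NO local definition survives in the skeleton;
(b) the RESHAPE the line card offers («RESHAPE OPTION (lead's call)»), APPLIED: the selector of the canonical member `W″`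
    is «`W″` has 2-ADICALLY MAXIMAL real Néron period in its isogeny class» instead of «`W″` is on the plateau».  The two
    selectors agree by the period-jump law at `2` (Dokchitser–Dokchitser 2015 L28/P30/P16) + concavity, but the maximal-period
    form needs NEITHER: stub 3 becomes pure finiteness (`WeierstrassCurve.finite_isogenyClass_holds`, AEC IX.6.2) + the
    invariance of `Ω` among globally minimal models (`realPeriodRat_variableChange_of_isGloballyMinimal_holds`) — S/M and
    landable now, no modularity, no Vélu — and stub 4 is card #8's extremal output VERBATIM (`reducibleWitness_of_extremal`
    yields `μ ≤ 0` for the member of MAXIMAL 2-adic period; no concavity lemma needed).  The jump law / concavity become an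
    OPTIONAL support lemma (plateau ⟺ maximal period), off the critical path.
(c) PUB in stub 4 is the Literature-level name `Literature.Uncategorized.OrdPublishedInputsAtTwo` (the body of item 19149's
    decl, `Iff.rfl`), so that a future stub-4 file needs no route-file import.

STUBS (history v4 → v12; 3 open in v12, all by-name/external: stub_pub [cite], stub_gamma1Optimal [cite], stub_lambdaHalf [external 19556]; (W) and (β) LANDED):
* `stub_pub`       — CITE-LEVEL, BY NAME (unchanged): 19149 ∧ 19567 ∧ Abbes–Ullmo.  Never proved in the line.
* `stub_lambdaHalf` — S3 crux 19556 BY NAME (unchanged; EXTERNAL).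
* `stub_maxPeriodWitness` (NEW in v4, replaces `stub_plateauWitness`; LANDED p653776 — imported, no longer a sorry): every elliptic, globally
    minimal `W/ℚ` is ℚ-isogenous to a globally minimal `W″` whose real period is 2-adically maximal in the class:
    `Ω(W₃) = q·Ω(W″)` with `W₃ ∼ W″` globally minimal forces `v₂(q) ≤ 0`.
* `stub_analyticMuLEAtMaxPeriod` (v4–v5, replaced `stub_analyticMuNonposOnPlateau`; REPLACED in v6 by the equivalent `stub_periodDescentOfMeasureDepth`; XL, the line's research-open crux in
    EXTREMAL form): modulo PUB and AU, if `W` is non-CM, analytic rank `0`, good ordinary at `2`, has a rational point of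
    order `2`, and `W″ ∼ W` is globally minimal of maximal 2-adic period, then `AnalyticMuLE W″ 2 0` (`μ(ϖ″·L₂) ≤ 0`:
    some coefficient of `ϖ″·L₂(f,α)` has norm `> 2⁻¹`).  By `μ`-transport (`ϖ‴/ϖ″ = Ω″/Ω‴`) the max-period member
    MINIMISES `μ(ϖ·L₂)` over the class, so this is «some member has `μ_an^{Nér} ≤ 0`» pinned to a canonical curve.
    Stub-plan: card #8 `odd-point-shimura-descent-two` v3/v4 (`reducibleWitness_of_extremal`; open inputs (α) `OddSpanGen N 4/16`,
    (β) `PeriodDescentOfEisensteinAtTwo`).  Census: `μ_an^{Nér} = 0` on the plateau (= max-period members, given the jump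
    law) of 179/179 reducible classes (j307730 L3).
COMPOSITION: `OrdMissingLowerBoundAtTwo_of` — the ONLY theorem concluding the route decl, hypothesis-free, closed over the
three by-name stubs (and the landed (W) `FlatWitnessTwo.flatWitnessAtTwo`, (β) `AnalyticMuTwo.periodDescentOfEisenstein_of_gamma1Optimal`) through the landed
`KatoFreeSandwich.ordMissingLowerBoundAtTwo_of_lambdaHalf_of_selector`.
BSD is not proved by any of this; 19577 is not closed by this file (the external crux 19556 and two cite-level stubs remain).
-/

set_option autoImplicit false
set_option linter.dupNamespace false

noncomputable section

open scoped Classical MatrixGroups ModularForm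

open CongruenceSubgroup WeierstrassCurve Literature.NumberTheory.EllipticCurves
  Literature.NumberTheory.EllipticCurves.ModularForms Literature.NumberTheory.EllipticCurves.Rank1Residual
  Literature.NumberTheory.EllipticCurves.Rank1Residual.Typed
  Literature.NumberTheory.EllipticCurves.Greenberg1999
  Summit.BirchSwinnertonDyer.Rank1Residual.X1.MuPart
  Summit.BirchSwinnertonDyer.Rank1Residual
  Summit.BirchSwinnertonDyer.BirchSwinnertonDyer.Theorems.KatoFreeSandwich

namespace Summit.BirchSwinnertonDyer.BirchSwinnertonDyer.Cruxes.OrdMissingLowerBoundAtTwo.KatoFreeLowerSandwichTwo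

/-! ## The stubs of the line (sorries live ONLY here; `stub_maxPeriodWitness` is the landed `KatoFreeSandwich.stub_maxPeriodWitness`,
(W) `stub_flatWitnessAtTwo(Composite)` is the landed `FlatWitnessTwo.flatWitnessAtTwo`, (β) `stub_periodDescentOfEisenstein` is the landed
`AnalyticMuTwo.periodDescentOfEisenstein_of_gamma1Optimal` applied to `stub_gamma1Optimal`) -/

/-- stub PUB-SIDE (CITE-LEVEL, BY NAME): K4 items 19149 `OrdPublishedInputsAtTwo` (modularity, Gross–Zagier–Kolyvagin,
Kato 17.4 (1)(2) at every prime incl. 2, Greenberg 4.1 at 2) and 19567 `OrdIsoPublishedInputsAtTwo` (Cassels isogeny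
invariance of the BSD quotient, entire `L`), and the Literature named fact `abbesUllmo_not_dvd_maninConstant_of_not_dvd_level`
(Abbes–Ullmo 1996 Thm. A).  Never proved in the line. -/
theorem stub_pub :
    Summit.BirchSwinnertonDyer.BirchSwinnertonDyer.Theses.ByReductionTypeAtTwo.OrdPublishedInputsAtTwo ∧
    Summit.BirchSwinnertonDyer.BirchSwinnertonDyer.Theses.ByReductionTypeAtTwo.OrdIsoPublishedInputsAtTwo ∧
    abbesUllmo_not_dvd_maninConstant_of_not_dvd_level := by
  sorry

/-- stub λ-HALF = S3's crux 19556 BY NAME (`λ(char X_E) ≥ λ(L₂(E))` on the good-ordinary non-CM locus; EXTERNAL). -/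
theorem stub_lambdaHalf :
    Summit.BirchSwinnertonDyer.BirchSwinnertonDyer.Theses.TwoAdicConverse.OrdLambdaHalfAtTwo := by
  sorry

/-- stub `X₁(N)`-OPTIMAL DATUM (CITE-LEVEL, BY NAME; v12): the Literature named fact
`exists_optimal_gamma1ParametrizationData` — every `X₀(N)`-lattice-optimal class carries a globally minimal `W₁` with an OPTIMAL
`Γ₁(N)`-parametrisation datum (`Λ_{W₁} = c₁Λ₁(f)`, `c₁ ∈ ℤ`): the `X₁(N)`-optimal curve (Stevens 1989 §2; Conrad–Edixhoven–Stein
2003 §6.1).  Through `AnalyticMuTwo.periodDescentOfEisenstein_of_gamma1Optimal` it yields v11's research stub (β)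
`stub_periodDescentOfEisenstein` verbatim.  Never proved in the line. [cite: Stevens1989, §2] -/
theorem stub_gamma1Optimal : exists_optimal_gamma1ParametrizationData := by
  sorry

/-! ## The composition (CLOSED; exactly ONE theorem concludes the ROUTE DECL, hypothesis-free over the stub NAMES) -/

/-- **19577 (the ROUTE DECL, by name) from the stubs**, through the landed
`KatoFreeSandwich.ordMissingLowerBoundAtTwo_of_lambdaHalf_of_selector` with the selector
`P W W″ :=` «`W″` has 2-adically maximal real period in its class», the landed `stub_maxPeriodWitness`, and the landed
equivalence `stubAtMaxPeriod_of_periodDescentOfMeasureDepth` (modularity from PUB via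
`exists_isNewformOf_of_nonempty_modularParametrizationData`). -/
theorem OrdMissingLowerBoundAtTwo_of :
    Summit.BirchSwinnertonDyer.BirchSwinnertonDyer.Theses.ByReductionTypeAtTwo.OrdMissingLowerBoundAtTwo := by
  obtain ⟨hP, ⟨hC, -⟩, hAU⟩ := stub_pub
  have hP' : Literature.Uncategorized.OrdPublishedInputsAtTwo := hP
  have hnf : exists_isNewformOf := exists_isNewformOf_of_nonempty_modularParametrizationData hP'.1
  exact ordMissingLowerBoundAtTwo_of_lambdaHalf_of_selector
    (fun _ W'' => ∀ (W₃ : WeierstrassCurve ℚ) [W₃.IsElliptic] [W₃.IsGloballyMinimal], IsIsogenous W'' W₃ →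
      ∀ q : ℚ, W₃.realPeriodRat = (q : ℝ) * W''.realPeriodRat → padicValRat 2 q ≤ 0)
    hP hC hAU stub_lambdaHalf
    (fun W _ _ _ _ => Summit.BirchSwinnertonDyer.BirchSwinnertonDyer.Theorems.KatoFreeSandwich.stub_maxPeriodWitness W)
    (fun W W'' _ _ _ _ =>
      stubAtMaxPeriod_of_periodDescentOfMeasureDepth hnf hAU
        (Summit.BirchSwinnertonDyer.BirchSwinnertonDyer.Theorems.AnalyticMuTwo.periodDescentOfMeasureDepth_of_flatWitness_of_eisensteinDescent
          Summit.BirchSwinnertonDyer.BirchSwinnertonDyer.Theorems.FlatWitnessTwo.flatWitnessAtTwo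
          (Summit.BirchSwinnertonDyer.BirchSwinnertonDyer.Theorems.AnalyticMuTwo.periodDescentOfEisenstein_of_gamma1Optimal
            stub_gamma1Optimal hP' hAU)) W W'')

end Summit.BirchSwinnertonDyer.BirchSwinnertonDyer.Cruxes.OrdMissingLowerBoundAtTwo.KatoFreeLowerSandwichTwo

end
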